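import Summits.ABC.IUTFork.Joshi.FrobenioidsJoshi

/-!
# Joshi, ATS III (arXiv 2401.13508v4) (10.2.12): `Φ(ℚ_p) = ℤ_p^⊳/ℤ_p^* ≃ ℤ_{≥0}` and `Φ(ℚ_p)^gp = ℤ` — DERIVABLE row
# of [J-III] §10.2, discharged over seat E-t32's carriers

Proof-only companion (abc-iut cell, branch E, seat abc-iut-E-t34; §4-fallback DERIVABLE discharge on E-t32's landed
`Joshi/FrobenioidsJoshi.lean` p430621; rung LADDER-ABC:A2.E). TAKES NO SIDE on [IUTchIII] Cor. 3.12 or on any author;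
typed ≠ proved; Mathlib arithmetic of the `p`-adic absolute value only. [claim: Joshi2024ATS3, status: disputed]

WHAT. Joshi (p.131 l.1–4): "If `K = ℚ_p` with the standard valuation `v_{ℚ_p}` on `ℚ_p`, then (10.2.12)
`Φ(ℚ_p) = ℤ_p^⊳/ℤ_p^* ≃ ℤ_{≥0}` and `Φ(ℚ_p)^gp = ℤ`". E-t32 proved the pointwise form `exists_zpow_of_mem_divGroup_padic`
(every value is `p^n`, `n ∈ ℤ`). Here the two ISOMORPHISMS themselves, on E-t32's value-coordinate carriers
`Frob.divMonoid (Frob.normAbs ℚ_[p]) ≤ Frob.divGroup (Frob.normAbs ℚ_[p]) ≤ ℝ^×`: `Φ(ℚ_p)^gp ≃ ℤ` generated by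
`|p⁻¹| = p` (`divGroup_padic_mulEquiv_int`) and `Φ(ℚ_p) ≃ ℤ_{≥0}` generated by `|p| = p⁻¹` (`divMonoid_padic_mulEquiv_nat`),
stated as `Nonempty (_ ≃* Multiplicative ℤ)` / `Nonempty (_ ≃* Multiplicative ℕ)` (proof-only file: no new data).
-/

noncomputable section

namespace Summit.ABC.IUTFork.Joshi.ATS3.Frob

variable (p : ℕ) [Fact p.Prime]

/-- **(10.2.12), group part: `Φ(ℚ_p)^gp = ℤ`** — the value group `|ℚ_p^*| ≤ ℝ^×` is infinite cyclic, generated by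
`|p⁻¹|_{ℚ_p} = p`. [claim: Joshi2024ATS3, status: disputed] -/
theorem divGroup_padic_mulEquiv_int : Nonempty (divGroup (normAbs ℚ_[p]) ≃* Multiplicative ℤ) := by
  have hp1 : (1 : ℝ) < p := by exact_mod_cast (Fact.out : p.Prime).one_lt
  have hpQ : (p : ℚ_[p]) ≠ 0 := by exact_mod_cast (Fact.out : p.Prime).ne_zero
  -- the generator `|p⁻¹| = p`
  let g : divGroup (normAbs ℚ_[p]) := prin (normAbs ℚ_[p]) (Units.mk0 (p : ℚ_[p]) hpQ)⁻¹
  have hg : ((g : ℝˣ) : ℝ) = p := by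
    change normAbs ℚ_[p] (((Units.mk0 (p : ℚ_[p]) hpQ)⁻¹ : ℚ_[p]ˣ) : ℚ_[p]) = p
    rw [Units.val_inv_eq_inv_val, Units.val_mk0, map_inv₀, normAbs_apply, Padic.norm_p, inv_inv]
  have hgz : ∀ n : ℤ, (((g ^ n : divGroup (normAbs ℚ_[p])) : ℝˣ) : ℝ) = (p : ℝ) ^ n := fun n => by
    rw [SubgroupClass.coe_zpow, Units.val_zpow_eq_zpow_val, hg]
  let f : Multiplicative ℤ →* divGroup (normAbs ℚ_[p]) := zpowersHom _ g
  have hf : ∀ n, f n = g ^ n.toAdd := fun n => by simp [f]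
  refine ⟨(MulEquiv.ofBijective f ⟨fun n m hnm => ?_, fun r => ?_⟩).symm⟩
  · have h := congrArg (fun r : divGroup (normAbs ℚ_[p]) => ((r : ℝˣ) : ℝ)) hnm
    simp only [hf, hgz] at h
    exact Multiplicative.toAdd.injective (zpow_right_injective₀ (lt_trans one_pos hp1) hp1.ne' h)
  · obtain ⟨n, hn⟩ := exists_zpow_of_mem_divGroup_padic p r.2
    exact ⟨Multiplicative.ofAdd n, Subtype.ext (Units.ext (by rw [hf, toAdd_ofAdd, hgz, ← hn]))⟩

/-- **(10.2.12), monoid part: `Φ(ℚ_p) = ℤ_p^⊳/ℤ_p^* ≃ ℤ_{≥0}`** — the value monoid `|ℤ_p^⊳| ≤ ℝ^×` is the free monoid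
on `|p|_{ℚ_p} = p⁻¹`. [claim: Joshi2024ATS3, status: disputed] -/
theorem divMonoid_padic_mulEquiv_nat : Nonempty (divMonoid (normAbs ℚ_[p]) ≃* Multiplicative ℕ) := by
  have hp1 : (1 : ℝ) < p := by exact_mod_cast (Fact.out : p.Prime).one_lt
  have hpQ : (p : ℚ_[p]) ≠ 0 := by exact_mod_cast (Fact.out : p.Prime).ne_zero
  have hp0 : (0 : ℝ) < p := lt_trans one_pos hp1
  -- the generator `|p| = p⁻¹ ≤ 1`
  have hmem : absUnits (normAbs ℚ_[p]) (Units.mk0 (p : ℚ_[p]) hpQ) ∈ divMonoid (normAbs ℚ_[p]) := by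
    rw [absUnits_mem_divMonoid_iff, Units.val_mk0, normAbs_apply]
    exact Padic.norm_p_lt_one.le
  let g : divMonoid (normAbs ℚ_[p]) := ⟨_, hmem⟩
  have hg : ((g : ℝˣ) : ℝ) = (p : ℝ)⁻¹ := by
    change normAbs ℚ_[p] ((Units.mk0 (p : ℚ_[p]) hpQ : ℚ_[p]ˣ) : ℚ_[p]) = (p : ℝ)⁻¹
    rw [Units.val_mk0, normAbs_apply, Padic.norm_p]
  have hgn : ∀ n : ℕ, (((g ^ n : divMonoid (normAbs ℚ_[p])) : ℝˣ) : ℝ) = (p : ℝ)⁻¹ ^ n := fun n => by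
    rw [SubmonoidClass.coe_pow, Units.val_pow_eq_pow_val, hg]
  let f : Multiplicative ℕ →* divMonoid (normAbs ℚ_[p]) := powersHom _ g
  have hf : ∀ n, f n = g ^ n.toAdd := fun n => by simp [f]
  have hpinv1 : (p : ℝ)⁻¹ ≠ 1 := by
    rw [Ne, inv_eq_one]; exact hp1.ne'
  refine ⟨(MulEquiv.ofBijective f ⟨fun n m hnm => ?_, fun r => ?_⟩).symm⟩
  · have h := congrArg (fun r : divMonoid (normAbs ℚ_[p]) => ((r : ℝˣ) : ℝ)) hnm
    simp only [hf, hgn] at h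
    exact Multiplicative.toAdd.injective (pow_right_injective₀ (inv_pos.mpr hp0) hpinv1 h)
  · obtain ⟨n, hn⟩ := exists_zpow_of_mem_divGroup_padic p (divMonoid_le_divGroup _ r.2)
    have hr1 : ((r : ℝˣ) : ℝ) ≤ 1 := by
      obtain ⟨x, hx, hxr⟩ := r.2
      rw [← hxr, val_absUnits]
      exact hx
    -- `p ^ n ≤ 1` forces `n ≤ 0`
    have hn0 : n ≤ 0 := by
      by_contra hpos
      have : (1 : ℝ) < (p : ℝ) ^ n := one_lt_zpow₀ hp1 (lt_of_not_ge hpos)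
      rw [← hn] at this
      exact absurd hr1 (not_le.mpr this)
    refine ⟨Multiplicative.ofAdd (-n).toNat, Subtype.ext (Units.ext ?_)⟩
    rw [hf, toAdd_ofAdd, hgn, hn, inv_pow, ← zpow_natCast, Int.toNat_of_nonneg (neg_nonneg.mpr hn0), zpow_neg, inv_inv]

end Summit.ABC.IUTFork.Joshi.ATS3.Frob

end
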